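import Summits.QuantumAdvantage.AdviceFreeQNC0.ProductBlocks
import HarnessLib

/-!
# Cell qa-qnc0 (rung F-Q1, route RingFrame, crux α `RingToElim`): TWO-DIMENSIONAL ROBUST
# HEGEDŰS — a low-degree function small on one product of residue classes is small everywhere

A window content of `L + M` bits is read as `w = x ++ z` (first `L` bits `x`, last `M` bits `z`, `ProductBlocks.lean`); the cell
`(i, j)` is `{w : |x| ≡ i, |z| ≡ j (mod 3)}`.

* `lowDeg_cell_extension` — for every `γ > 0` there are `ε, c₁ > 0`, `n₀` such that for
  `L, M ≥ n₀`, `D ≤ c₁√L`, `D ≤ c₁√M`, a Boolean function of `𝔽₂`-degree `≤ D` on `{0,1}^{L+M}`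
  that is `true` on at most `ε·2^{L+M}` points of ONE cell is `true` on at most `γ·2^{L+M}` points
  altogether.  Proof: the tree's `lowDegAvoidMod3Sparse` (the `𝔽₂` instance of Srinivasan's robust
  Hegedűs lemma) along the rows of the class `{|z| ≡ j}` (good rows by the lemma on the `L`-cube,
  bad rows by Markov), then along all columns on the `M`-cube.
* `exists_const_of_xor_small` — separation of variables: if `F(x) ⊕ G(z)` is `true` on at most
  `ε·2^{L+M}` points (`ε ≤ 1/4`) then `F` and `G` are both `ε`-close to one common constant
  (elementary).

The first is the engine of the blind-window theorem (`CellParityObstruction.lean`).  The cell's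
statements (prover qn-prover-3, 2026-08-27); a routine product version of [Srinivasan2023,
Lemma 3.1], not in print in this form.  WHAT THIS IS NOT: no statement about walk strategies here;
constants are not optimised; no separation.

## References

* S. Srinivasan, *A robust version of Hegedűs's lemma, with applications*, TheoretiCS 2 (2023),
  Lemma 3.1 [Srinivasan2023] (through `lowDegAvoidMod3Sparse`).
-/

noncomputable section

namespace Summit.QuantumAdvantage.AdviceFreeQNC0

open Finset
open Literature.Computability.MetaComplexity Literature.Computability.MetaComplexity.Smolensky

variable {L M : ℕ}

/-! ### Two-dimensional robust Hegedűs -/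

/-- One-dimensional step along the rows: a degree-`≤ D` function on `{0,1}^{L+M}` whose `true`-set
meets the cell `(i, j)` in `≤ ε·2^{L+M}` points meets the strip `{|z| ≡ j}` in
`≤ (γ₁ + ε/η₁)·2^{L+M}` points, where `(γ₁, η₁)` is a pair from `lowDegAvoidMod3Sparse` on the
`L`-cube. -/
private theorem strip_bound {D : ℕ} {γ₁ η₁ ε : ℝ} (hγ₁ : 0 ≤ γ₁) (hη₁ : 0 < η₁)
    (hH : ∀ r : ℕ, ∀ g : CubeFn (ZMod 2) L, g ∈ lowDeg (ZMod 2) L D →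
      ((univ.filter fun u : Fin L → Bool => g u ≠ 0 ∧ Hegedus.wt u % 3 = r % 3).card : ℝ) ≤
          η₁ * (2 : ℝ) ^ L →
        ((univ.filter fun u : Fin L → Bool => g u ≠ 0).card : ℝ) ≤ γ₁ * (2 : ℝ) ^ L)
    (i j : ℕ) (R : (Fin (L + M) → Bool) → Bool) (hR : HasDeg R D)
    (hcell : ((univ.filter fun w : Fin (L + M) → Bool =>
      R w = true ∧ wt (fun i : Fin L => w (Fin.castAdd M i)) % 3 = i % 3 ∧ wt (fun j : Fin M => w (Fin.natAdd L j)) % 3 = j % 3).card : ℝ) ≤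
        ε * (2 : ℝ) ^ (L + M)) :
    ((univ.filter fun w : Fin (L + M) → Bool => R w = true ∧ wt (fun j : Fin M => w (Fin.natAdd L j)) % 3 = j % 3).card : ℝ) ≤
      (γ₁ + ε / η₁) * (2 : ℝ) ^ (L + M) := by
  classical
  -- row counts
  set f : (Fin M → Bool) → ℕ := fun z =>
    (univ.filter fun x : Fin L → Bool => R (Fin.append x z) = true ∧ wt x % 3 = i % 3).card with hf
  set F : (Fin M → Bool) → ℕ := fun z =>
    (univ.filter fun x : Fin L → Bool => R (Fin.append x z) = true).card with hF
  set Zj := (univ.filter fun z : Fin M → Bool => wt z % 3 = j % 3) with hZj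
  set Bad := Zj.filter fun z => η₁ * (2 : ℝ) ^ L < (f z : ℝ) with hBad
  set Good := Zj.filter fun z => ¬ (η₁ * (2 : ℝ) ^ L < (f z : ℝ)) with hGood
  -- the cell count is the sum of the row counts over the class
  have hcellsum : ((univ.filter fun w : Fin (L + M) → Bool =>
      R w = true ∧ wt (fun i : Fin L => w (Fin.castAdd M i)) % 3 = i % 3 ∧ wt (fun j : Fin M => w (Fin.natAdd L j)) % 3 = j % 3).card) = ∑ z ∈ Zj, f z := by
    rw [card_filter_eq_sum_right, hZj, Finset.sum_filter]
    refine Finset.sum_congr rfl fun z _ => ?_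
    by_cases hz : wt z % 3 = j % 3
    · rw [if_pos hz, hf]
      congr 1
      exact Finset.filter_congr fun x _ => by simp [hz]
    · rw [if_neg hz, Finset.card_eq_zero, Finset.filter_eq_empty_iff]
      intro x _; simp [hz]
  -- the strip count is the sum of the full row counts over the class
  have hstripsum : ((univ.filter fun w : Fin (L + M) → Bool =>
      R w = true ∧ wt (fun j : Fin M => w (Fin.natAdd L j)) % 3 = j % 3).card) = ∑ z ∈ Zj, F z := by
    rw [card_filter_eq_sum_right, hZj, Finset.sum_filter]
    refine Finset.sum_congr rfl fun z _ => ?_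
    by_cases hz : wt z % 3 = j % 3
    · rw [if_pos hz, hF]
      congr 1
      exact Finset.filter_congr fun x _ => by simp [hz]
    · rw [if_neg hz, Finset.card_eq_zero, Finset.filter_eq_empty_iff]
      intro x _; simp [hz]
  -- Markov: few bad rows
  have hBadcard : (Bad.card : ℝ) * (η₁ * (2 : ℝ) ^ L) ≤ ε * (2 : ℝ) ^ (L + M) := by
    have h1 : (Bad.card : ℝ) * (η₁ * (2 : ℝ) ^ L) ≤ ∑ z ∈ Bad, (f z : ℝ) := by
      rw [← nsmul_eq_mul]
      exact Finset.card_nsmul_le_sum Bad _ _ (fun z hz => le_of_lt (Finset.mem_filter.1 hz).2)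
    have h2 : ∑ z ∈ Bad, (f z : ℝ) ≤ ∑ z ∈ Zj, (f z : ℝ) :=
      Finset.sum_le_sum_of_subset_of_nonneg (Finset.filter_subset _ _) (fun _ _ _ => Nat.cast_nonneg _)
    have h3 : ∑ z ∈ Zj, (f z : ℝ) ≤ ε * (2 : ℝ) ^ (L + M) := by
      have := hcell
      rw [hcellsum] at this
      push_cast at this
      exact this
    linarith
  -- good rows: the robust Hegedűs lemma on the `L`-cube
  have hgood : ∀ z ∈ Good, (F z : ℝ) ≤ γ₁ * (2 : ℝ) ^ L := by
    intro z hz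
    have hfz : (f z : ℝ) ≤ η₁ * (2 : ℝ) ^ L := le_of_not_gt (Finset.mem_filter.1 hz).2
    have hdeg : HasDeg (fun x : Fin L → Bool => R (Fin.append x z)) D := hasDeg_append_left z hR
    have h := hH i (fun x => if R (Fin.append x z) = true then (1 : ZMod 2) else 0) hdeg
    have hsupp_i : ((univ.filter fun u : Fin L → Bool =>
        (fun x => if R (Fin.append x z) = true then (1 : ZMod 2) else 0) u ≠ 0 ∧
          Hegedus.wt u % 3 = i % 3).card : ℝ) ≤ η₁ * (2 : ℝ) ^ L := by
      have heq : (univ.filter fun u : Fin L → Bool =>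
          (fun x => if R (Fin.append x z) = true then (1 : ZMod 2) else 0) u ≠ 0 ∧
            Hegedus.wt u % 3 = i % 3) =
          univ.filter fun x : Fin L → Bool => R (Fin.append x z) = true ∧ wt x % 3 = i % 3 := by
        refine Finset.filter_congr fun u _ => ?_
        by_cases hu : R (Fin.append u z) = true <;> simp [hu, Hegedus.wt, wt]
      rw [heq]; exact hfz
    have h2 := h hsupp_i
    have heq2 : (univ.filter fun u : Fin L → Bool =>
        (fun x => if R (Fin.append x z) = true then (1 : ZMod 2) else 0) u ≠ 0) =
        univ.filter fun x : Fin L → Bool => R (Fin.append x z) = true :=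
      Finset.filter_congr fun u _ => by by_cases hu : R (Fin.append u z) = true <;> simp [hu]
    rw [heq2] at h2
    exact h2
  have hFle : ∀ z, (F z : ℝ) ≤ (2 : ℝ) ^ L := fun z => by
    have : F z ≤ 2 ^ L := le_trans (Finset.card_filter_le _ _) (by simp)
    exact_mod_cast this
  have hZjle : (Zj.card : ℝ) ≤ (2 : ℝ) ^ M := by
    have : Zj.card ≤ 2 ^ M := le_trans (Finset.card_filter_le _ _) (by simp)
    exact_mod_cast this
  have hsplit : ∑ z ∈ Zj, (F z : ℝ) = ∑ z ∈ Good, (F z : ℝ) + ∑ z ∈ Bad, (F z : ℝ) := by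
    rw [hGood, hBad, ← Finset.sum_filter_add_sum_filter_not Zj (fun z => η₁ * (2 : ℝ) ^ L < (f z : ℝ))]
    ring
  have hGoodsum : ∑ z ∈ Good, (F z : ℝ) ≤ γ₁ * (2 : ℝ) ^ (L + M) := by
    calc ∑ z ∈ Good, (F z : ℝ) ≤ ∑ z ∈ Good, γ₁ * (2 : ℝ) ^ L := Finset.sum_le_sum hgood
      _ = Good.card * (γ₁ * (2 : ℝ) ^ L) := by rw [Finset.sum_const, nsmul_eq_mul]
      _ ≤ (2 : ℝ) ^ M * (γ₁ * (2 : ℝ) ^ L) := by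
          have hG : (Good.card : ℝ) ≤ (2 : ℝ) ^ M :=
            le_trans (by exact_mod_cast Finset.card_filter_le _ _) hZjle
          have hγ₁' : 0 ≤ γ₁ * (2 : ℝ) ^ L := by positivity
          nlinarith
      _ = γ₁ * (2 : ℝ) ^ (L + M) := by rw [pow_add]; ring
  have hBadsum : ∑ z ∈ Bad, (F z : ℝ) ≤ ε / η₁ * (2 : ℝ) ^ (L + M) := by
    calc ∑ z ∈ Bad, (F z : ℝ) ≤ ∑ z ∈ Bad, (2 : ℝ) ^ L := Finset.sum_le_sum fun z _ => hFle z
      _ = Bad.card * (2 : ℝ) ^ L := by rw [Finset.sum_const, nsmul_eq_mul]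
      _ ≤ ε / η₁ * (2 : ℝ) ^ (L + M) := by
          rw [pow_add]
          have : (Bad.card : ℝ) ≤ ε / η₁ * (2 : ℝ) ^ M := by
            rw [div_mul_eq_mul_div, le_div_iff₀ hη₁]
            calc (Bad.card : ℝ) * η₁ = (Bad.card : ℝ) * (η₁ * (2 : ℝ) ^ L) / (2 : ℝ) ^ L := by
                  field_simp
              _ ≤ ε * (2 : ℝ) ^ (L + M) / (2 : ℝ) ^ L :=
                  div_le_div_of_nonneg_right hBadcard (by positivity)
              _ = ε * (2 : ℝ) ^ M := by rw [pow_add]; field_simp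
          nlinarith [pow_pos (show (0:ℝ) < 2 by norm_num) L]
  rw [hstripsum]
  push_cast
  rw [hsplit]
  nlinarith

/-- **Two-dimensional robust Hegedűs lemma.**  For every `γ > 0` there are `ε, c₁ > 0` and `n₀`
such that for all `L, M ≥ n₀`, every `D` with `D ≤ c₁√L`, `D ≤ c₁√M`, every cell `(i, j)` and
every Boolean function `R` of `𝔽₂`-degree `≤ D` on `{0,1}^{L+M}`: if `R` is `true` on at most
`ε·2^{L+M}` points of the cell `{|x| ≡ i, |z| ≡ j}`, then `R` is `true` on at most `γ·2^{L+M}`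
points.  (Rows: `lowDegAvoidMod3Sparse` on the `L`-cube for the good rows of the class, Markov for
the bad ones; then the same along the columns.)  [cite: Srinivasan2023, Lemma 3.1] -/
theorem lowDeg_cell_extension :
    ∀ γ : ℝ, 0 < γ → ∃ ε : ℝ, 0 < ε ∧ ∃ c₁ : ℝ, 0 < c₁ ∧ ∃ n₀ : ℕ, ∀ L M : ℕ, n₀ ≤ L → n₀ ≤ M →
      ∀ D : ℕ, (D : ℝ) ≤ c₁ * Real.sqrt L → (D : ℝ) ≤ c₁ * Real.sqrt M → ∀ i j : ℕ,
      ∀ R : (Fin (L + M) → Bool) → Bool, HasDeg R D →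
        ((univ.filter fun w : Fin (L + M) → Bool =>
          R w = true ∧ wt (fun i : Fin L => w (Fin.castAdd M i)) % 3 = i % 3 ∧ wt (fun j : Fin M => w (Fin.natAdd L j)) % 3 = j % 3).card : ℝ) ≤
            ε * (2 : ℝ) ^ (L + M) →
        ((univ.filter fun w : Fin (L + M) → Bool => R w = true).card : ℝ) ≤ γ * (2 : ℝ) ^ (L + M) := by
  intro γ hγ
  -- second stage (columns) at `γ/2`, first stage (rows) at `γ η₂ / 4`
  obtain ⟨η₂, hη₂, c₂, hc₂, n₂, H₂⟩ := lowDegAvoidMod3Sparse (γ / 2) (by positivity)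
  obtain ⟨η₁, hη₁, c₁, hc₁, n₁, H₁⟩ := lowDegAvoidMod3Sparse (γ * η₂ / 4) (by positivity)
  refine ⟨γ * η₂ / 4 * η₁, by positivity, min c₁ c₂, lt_min hc₁ hc₂, max n₁ n₂, ?_⟩
  intro L M hL hM D hDL hDM i j R hR hcell
  have hn₁L : n₁ ≤ L := le_trans (le_max_left _ _) hL
  have hn₂M : n₂ ≤ M := le_trans (le_max_right _ _) hM
  have hDL' : (D : ℝ) ≤ c₁ * Real.sqrt L :=
    le_trans hDL (mul_le_mul_of_nonneg_right (min_le_left _ _) (Real.sqrt_nonneg _))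
  have hDM' : (D : ℝ) ≤ c₂ * Real.sqrt M :=
    le_trans hDM (mul_le_mul_of_nonneg_right (min_le_right _ _) (Real.sqrt_nonneg _))
  -- stage 1: the strip `{|z| ≡ j}`
  have hstrip := strip_bound (M := M) (by positivity) hη₁
    (fun r g hg hS => H₁ L hn₁L r D hDL' g hg hS) i j R hR hcell
  have hε' : γ * η₂ / 4 + γ * η₂ / 4 * η₁ / η₁ = γ * η₂ / 2 := by
    field_simp; ring
  rw [hε'] at hstrip
  -- stage 2: columns, via the symmetric strip bound on the swapped product
  -- column counts
  set f : (Fin L → Bool) → ℕ := fun x =>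
    (univ.filter fun z : Fin M → Bool => R (Fin.append x z) = true ∧ wt z % 3 = j % 3).card with hf
  set F : (Fin L → Bool) → ℕ := fun x =>
    (univ.filter fun z : Fin M → Bool => R (Fin.append x z) = true).card with hF
  set Bad := (univ : Finset (Fin L → Bool)).filter fun x => η₂ * (2 : ℝ) ^ M < (f x : ℝ) with hBad
  set Good := (univ : Finset (Fin L → Bool)).filter fun x => ¬ (η₂ * (2 : ℝ) ^ M < (f x : ℝ))
    with hGood
  have hstripsum : ((univ.filter fun w : Fin (L + M) → Bool =>
      R w = true ∧ wt (fun j : Fin M => w (Fin.natAdd L j)) % 3 = j % 3).card) = ∑ x : Fin L → Bool, f x := by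
    rw [card_filter_eq_sum_left]
    refine Finset.sum_congr rfl fun x _ => ?_
    rw [hf]
    congr 1
    exact Finset.filter_congr fun z _ => by simp
  have htotsum : ((univ.filter fun w : Fin (L + M) → Bool => R w = true).card) =
      ∑ x : Fin L → Bool, F x := by
    rw [card_filter_eq_sum_left]
  have hBadcard : (Bad.card : ℝ) * (η₂ * (2 : ℝ) ^ M) ≤ γ * η₂ / 2 * (2 : ℝ) ^ (L + M) := by
    have h1 : (Bad.card : ℝ) * (η₂ * (2 : ℝ) ^ M) ≤ ∑ x ∈ Bad, (f x : ℝ) := by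
      rw [← nsmul_eq_mul]
      exact Finset.card_nsmul_le_sum Bad _ _ (fun x hx => le_of_lt (Finset.mem_filter.1 hx).2)
    have h2 : ∑ x ∈ Bad, (f x : ℝ) ≤ ∑ x : Fin L → Bool, (f x : ℝ) :=
      Finset.sum_le_sum_of_subset_of_nonneg (Finset.subset_univ _) (fun _ _ _ => Nat.cast_nonneg _)
    have h3 : ∑ x : Fin L → Bool, (f x : ℝ) ≤ γ * η₂ / 2 * (2 : ℝ) ^ (L + M) := by
      have := hstrip
      rw [hstripsum] at this
      push_cast at this
      exact this
    linarith
  have hgood : ∀ x ∈ Good, (F x : ℝ) ≤ γ / 2 * (2 : ℝ) ^ M := by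
    intro x hx
    have hfx : (f x : ℝ) ≤ η₂ * (2 : ℝ) ^ M := le_of_not_gt (Finset.mem_filter.1 hx).2
    have hdeg : HasDeg (fun z : Fin M → Bool => R (Fin.append x z)) D := hasDeg_append_right x hR
    have h := H₂ M hn₂M j D hDM' (fun z => if R (Fin.append x z) = true then (1 : ZMod 2) else 0) hdeg
    have heq : (univ.filter fun u : Fin M → Bool =>
        (fun z => if R (Fin.append x z) = true then (1 : ZMod 2) else 0) u ≠ 0 ∧
          Hegedus.wt u % 3 = j % 3) =
        univ.filter fun z : Fin M → Bool => R (Fin.append x z) = true ∧ wt z % 3 = j % 3 := by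
      refine Finset.filter_congr fun u _ => ?_
      by_cases hu : R (Fin.append x u) = true <;> simp [hu, Hegedus.wt, wt]
    rw [heq] at h
    have h2 := h hfx
    have heq2 : (univ.filter fun u : Fin M → Bool =>
        (fun z => if R (Fin.append x z) = true then (1 : ZMod 2) else 0) u ≠ 0) =
        univ.filter fun z : Fin M → Bool => R (Fin.append x z) = true :=
      Finset.filter_congr fun u _ => by by_cases hu : R (Fin.append x u) = true <;> simp [hu]
    rw [heq2] at h2
    exact h2
  have hFle : ∀ x, (F x : ℝ) ≤ (2 : ℝ) ^ M := fun x => by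
    have : F x ≤ 2 ^ M := le_trans (Finset.card_filter_le _ _) (by simp)
    exact_mod_cast this
  have hsplit : ∑ x : Fin L → Bool, (F x : ℝ) = ∑ x ∈ Good, (F x : ℝ) + ∑ x ∈ Bad, (F x : ℝ) := by
    rw [hGood, hBad, ← Finset.sum_filter_add_sum_filter_not univ (fun x => η₂ * (2 : ℝ) ^ M < (f x : ℝ))]
    ring
  have hGoodsum : ∑ x ∈ Good, (F x : ℝ) ≤ γ / 2 * (2 : ℝ) ^ (L + M) := by
    calc ∑ x ∈ Good, (F x : ℝ) ≤ ∑ x ∈ Good, γ / 2 * (2 : ℝ) ^ M := Finset.sum_le_sum hgood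
      _ = Good.card * (γ / 2 * (2 : ℝ) ^ M) := by rw [Finset.sum_const, nsmul_eq_mul]
      _ ≤ (2 : ℝ) ^ L * (γ / 2 * (2 : ℝ) ^ M) := by
          have hG : (Good.card : ℝ) ≤ (2 : ℝ) ^ L := by
            have : Good.card ≤ 2 ^ L := le_trans (Finset.card_filter_le _ _) (by simp)
            exact_mod_cast this
          have : 0 ≤ γ / 2 * (2 : ℝ) ^ M := by positivity
          nlinarith
      _ = γ / 2 * (2 : ℝ) ^ (L + M) := by rw [pow_add]; ring
  have hBadsum : ∑ x ∈ Bad, (F x : ℝ) ≤ γ / 2 * (2 : ℝ) ^ (L + M) := by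
    calc ∑ x ∈ Bad, (F x : ℝ) ≤ ∑ x ∈ Bad, (2 : ℝ) ^ M := Finset.sum_le_sum fun x _ => hFle x
      _ = Bad.card * (2 : ℝ) ^ M := by rw [Finset.sum_const, nsmul_eq_mul]
      _ ≤ γ / 2 * (2 : ℝ) ^ (L + M) := by
          have hB : (Bad.card : ℝ) * (2 : ℝ) ^ M * η₂ ≤ γ / 2 * (2 : ℝ) ^ (L + M) * η₂ := by
            calc (Bad.card : ℝ) * (2 : ℝ) ^ M * η₂ = (Bad.card : ℝ) * (η₂ * (2 : ℝ) ^ M) := by ring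
              _ ≤ γ * η₂ / 2 * (2 : ℝ) ^ (L + M) := hBadcard
              _ = γ / 2 * (2 : ℝ) ^ (L + M) * η₂ := by ring
          exact le_of_mul_le_mul_right hB hη₂
  rw [htotsum]
  push_cast
  rw [hsplit]
  linarith

/-! ### Separation of variables -/

/-- **Separation of variables.**  If `F(x) ⊕ G(z)` is `true` on at most `ε·2^{L+M}` points with
`ε ≤ 1/4`, then there is ONE constant `a` with `#{x : F x ≠ a} ≤ ε·2^L` and `#{z : G z ≠ a} ≤ ε·2^M`.
(A light row `z₀` gives `a = G z₀`, a light column `x₀` gives `b = F x₀`, and `a ≠ b` would put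
the `(1−ε)²`-fraction rectangle `{F = a} × {G = b}` inside the small set.) [folklore] -/
theorem exists_const_of_xor_small (F : (Fin L → Bool) → Bool) (G : (Fin M → Bool) → Bool) {ε : ℝ}
    (hε : ε ≤ 1 / 4)
    (h : ((univ.filter fun w : Fin (L + M) → Bool => xor (F (fun i : Fin L => w (Fin.castAdd M i))) (G (fun j : Fin M => w (Fin.natAdd L j))) = true).card : ℝ) ≤
      ε * (2 : ℝ) ^ (L + M)) :
    ∃ a : Bool, ((univ.filter fun x : Fin L → Bool => F x ≠ a).card : ℝ) ≤ ε * (2 : ℝ) ^ L ∧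
      ((univ.filter fun z : Fin M → Bool => G z ≠ a).card : ℝ) ≤ ε * (2 : ℝ) ^ M := by
  classical
  set S : (Fin (L + M) → Bool) → Prop := fun w => xor (F (fun i : Fin L => w (Fin.castAdd M i))) (G (fun j : Fin M => w (Fin.natAdd L j))) = true with hS
  have hpos : (0 : ℝ) < (2 : ℝ) ^ (L + M) := by positivity
  have hεnn : 0 ≤ ε := by
    have h0 : (0 : ℝ) ≤ ε * (2 : ℝ) ^ (L + M) := le_trans (Nat.cast_nonneg _) h
    nlinarith
  -- a light row: average over all `z`
  have hrow : ∃ z₀ : Fin M → Bool,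
      ((univ.filter fun x : Fin L → Bool => S (Fin.append x z₀)).card : ℝ) ≤ ε * (2 : ℝ) ^ L := by
    obtain ⟨z₀, -, hmin⟩ := Finset.exists_min_image (univ : Finset (Fin M → Bool))
      (fun z => (univ.filter fun x : Fin L → Bool => S (Fin.append x z)).card) Finset.univ_nonempty
    refine ⟨z₀, ?_⟩
    set f : (Fin M → Bool) → ℕ := fun z => (univ.filter fun x : Fin L → Bool => S (Fin.append x z)).card
    have h1 : (univ : Finset (Fin M → Bool)).card * f z₀ ≤ ∑ z, f z := by
      have := Finset.card_nsmul_le_sum univ f (f z₀) (fun z hz => hmin z hz)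
      simpa using this
    have h2 : ∑ z, f z = (univ.filter fun w : Fin (L + M) → Bool => S w).card := by
      rw [card_filter_eq_sum_right]
    have h3 : ((2 ^ M * f z₀ : ℕ) : ℝ) ≤ ε * (2 : ℝ) ^ (L + M) := by
      have : ((univ : Finset (Fin M → Bool)).card * f z₀ : ℕ) = 2 ^ M * f z₀ := by simp
      rw [← this]
      exact le_trans (by exact_mod_cast (h1.trans h2.le)) h
    push_cast at h3
    rw [pow_add] at h3
    have : (f z₀ : ℝ) * (2 : ℝ) ^ M ≤ ε * (2 : ℝ) ^ L * (2 : ℝ) ^ M := by nlinarith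
    exact le_of_mul_le_mul_right this (by positivity)
  have hcol : ∃ x₀ : Fin L → Bool,
      ((univ.filter fun z : Fin M → Bool => S (Fin.append x₀ z)).card : ℝ) ≤ ε * (2 : ℝ) ^ M := by
    obtain ⟨x₀, -, hmin⟩ := Finset.exists_min_image (univ : Finset (Fin L → Bool))
      (fun x => (univ.filter fun z : Fin M → Bool => S (Fin.append x z)).card) Finset.univ_nonempty
    refine ⟨x₀, ?_⟩
    set f : (Fin L → Bool) → ℕ := fun x => (univ.filter fun z : Fin M → Bool => S (Fin.append x z)).card
    have h1 : (univ : Finset (Fin L → Bool)).card * f x₀ ≤ ∑ x, f x := by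
      have := Finset.card_nsmul_le_sum univ f (f x₀) (fun x hx => hmin x hx)
      simpa using this
    have h2 : ∑ x, f x = (univ.filter fun w : Fin (L + M) → Bool => S w).card := by
      rw [card_filter_eq_sum_left]
    have h3 : ((2 ^ L * f x₀ : ℕ) : ℝ) ≤ ε * (2 : ℝ) ^ (L + M) := by
      have : ((univ : Finset (Fin L → Bool)).card * f x₀ : ℕ) = 2 ^ L * f x₀ := by simp
      rw [← this]
      exact le_trans (by exact_mod_cast (h1.trans h2.le)) h
    push_cast at h3
    rw [pow_add] at h3
    have : (f x₀ : ℝ) * (2 : ℝ) ^ L ≤ ε * (2 : ℝ) ^ M * (2 : ℝ) ^ L := by nlinarith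
    exact le_of_mul_le_mul_right this (by positivity)
  obtain ⟨z₀, hz₀⟩ := hrow
  obtain ⟨x₀, hx₀⟩ := hcol
  -- `F x ≠ G z₀` iff `S (x ++ z₀)`; `G z ≠ F x₀` iff `S (x₀ ++ z)`
  have hFa : ((univ.filter fun x : Fin L → Bool => F x ≠ G z₀).card : ℝ) ≤ ε * (2 : ℝ) ^ L := by
    have heq : (univ.filter fun x : Fin L → Bool => F x ≠ G z₀) =
        univ.filter fun x : Fin L → Bool => S (Fin.append x z₀) := by
      refine Finset.filter_congr fun x _ => ?_
      simp only [hS, left_of_append, right_of_append]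
      cases F x <;> cases G z₀ <;> simp
    rw [heq]; exact hz₀
  have hGb : ((univ.filter fun z : Fin M → Bool => G z ≠ F x₀).card : ℝ) ≤ ε * (2 : ℝ) ^ M := by
    have heq : (univ.filter fun z : Fin M → Bool => G z ≠ F x₀) =
        univ.filter fun z : Fin M → Bool => S (Fin.append x₀ z) := by
      refine Finset.filter_congr fun z _ => ?_
      simp only [hS, left_of_append, right_of_append]
      cases F x₀ <;> cases G z <;> simp
    rw [heq]; exact hx₀
  by_cases hab : G z₀ = F x₀
  · exact ⟨G z₀, hFa, by rw [hab]; exact hGb⟩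
  · -- the rectangle `{F = G z₀} × {G = F x₀}` lies in `S`
    exfalso
    have hrect : (univ.filter fun w : Fin (L + M) → Bool =>
        F (fun i : Fin L => w (Fin.castAdd M i)) = G z₀ ∧ G (fun j : Fin M => w (Fin.natAdd L j)) = F x₀) ⊆ univ.filter fun w => S w := by
      intro w hw
      simp only [Finset.mem_filter, Finset.mem_univ, true_and] at hw ⊢
      simp only [hS, hw.1, hw.2]
      revert hab
      cases G z₀ <;> cases F x₀ <;> simp
    have hcardrect := Finset.card_le_card hrect
    have hce : (univ.filter fun w : Fin (L + M) → Bool =>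
        F (fun i : Fin L => w (Fin.castAdd M i)) = G z₀ ∧ G (fun j : Fin M => w (Fin.natAdd L j)) = F x₀).card =
        (univ.filter fun x : Fin L → Bool => F x = G z₀).card *
          (univ.filter fun z : Fin M → Bool => G z = F x₀).card :=
      card_filter_blocks (fun x => F x = G z₀) (fun z => G z = F x₀)
    rw [hce] at hcardrect
    -- the sides of the rectangle
    have hA : (1 - ε) * (2 : ℝ) ^ L ≤ ((univ.filter fun x : Fin L → Bool => F x = G z₀).card : ℝ) := by
      have hc : ((univ.filter fun x : Fin L → Bool => F x = G z₀).card : ℝ) +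
          ((univ.filter fun x : Fin L → Bool => ¬ (F x = G z₀)).card : ℝ) = (2 : ℝ) ^ L := by
        rw [← Nat.cast_add, Finset.card_filter_add_card_filter_not]; simp
      have hne : ((univ.filter fun x : Fin L → Bool => ¬ (F x = G z₀)).card : ℝ) ≤ ε * (2 : ℝ) ^ L := hFa
      linarith
    have hB : (1 - ε) * (2 : ℝ) ^ M ≤ ((univ.filter fun z : Fin M → Bool => G z = F x₀).card : ℝ) := by
      have hc : ((univ.filter fun z : Fin M → Bool => G z = F x₀).card : ℝ) +
          ((univ.filter fun z : Fin M → Bool => ¬ (G z = F x₀)).card : ℝ) = (2 : ℝ) ^ M := by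
        rw [← Nat.cast_add, Finset.card_filter_add_card_filter_not]; simp
      have hne : ((univ.filter fun z : Fin M → Bool => ¬ (G z = F x₀)).card : ℝ) ≤ ε * (2 : ℝ) ^ M := hGb
      linarith
    have hprod : (1 - ε) * (2 : ℝ) ^ L * ((1 - ε) * (2 : ℝ) ^ M) ≤
        ((univ.filter fun w : Fin (L + M) → Bool => S w).card : ℝ) := by
      have h1 : (1 - ε) * (2 : ℝ) ^ L * ((1 - ε) * (2 : ℝ) ^ M) ≤
          ((univ.filter fun x : Fin L → Bool => F x = G z₀).card : ℝ) *
            ((univ.filter fun z : Fin M → Bool => G z = F x₀).card : ℝ) :=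
        mul_le_mul hA hB (by nlinarith [pow_pos (show (0:ℝ) < 2 by norm_num) M]) (Nat.cast_nonneg _)
      have h2 : (((univ.filter fun x : Fin L → Bool => F x = G z₀).card *
          (univ.filter fun z : Fin M → Bool => G z = F x₀).card : ℕ) : ℝ) ≤
          ((univ.filter fun w : Fin (L + M) → Bool => S w).card : ℝ) := by exact_mod_cast hcardrect
      push_cast at h2
      linarith
    have hfin : (1 - ε) * (1 - ε) * (2 : ℝ) ^ (L + M) ≤ ε * (2 : ℝ) ^ (L + M) := by
      rw [pow_add]
      calc (1 - ε) * (1 - ε) * ((2 : ℝ) ^ L * (2 : ℝ) ^ M)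
          = (1 - ε) * (2 : ℝ) ^ L * ((1 - ε) * (2 : ℝ) ^ M) := by ring
        _ ≤ ((univ.filter fun w : Fin (L + M) → Bool => S w).card : ℝ) := hprod
        _ ≤ ε * ((2 : ℝ) ^ L * (2 : ℝ) ^ M) := by rw [← pow_add]; exact h
    have : (1 - ε) * (1 - ε) ≤ ε := le_of_mul_le_mul_right hfin hpos
    nlinarith

end Summit.QuantumAdvantage.AdviceFreeQNC0
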